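import Summits.ABC.StewartYu.ArchG3RecLinesKFb
import HarnessLib

/-!
# The archimedean record `ArchG3Rec` — letter lines in closed form, file KF: THE (F) BUDGET LINES of the k-steps and odd steps

Support file (theorems only; no named facts). Cell `abc-stewartyu`, route `YuMatveevShapeRat`, crux r2 `ArchCoreRat`
(stmt-ABC-20502), line `arch-g3-frame`, stub `stub_recLinesArch`; R50 (plan g12 22:00Z): the (F) conjuncts of p5's closed lines
`KStepLinesK (2^(n−1)) c lev ν` (families K0: `lev = 0`, `ν < n`; K: `lev+1 ≤ Ŝ`, `1 ≤ ν < n`) and `OddStepLinesK (2^(n−1)) c lev`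
(family O), VERBATIM, for every `n ≥ 2`, `lev ≤ Ŝ`, `ν < n` and every constant `c ≥ 2^63` (p4's `U0_ge 3`); no sortedness needed.
* `kstepF_holds`: per step the costs are `≤ (2.34 + 0.35·2^ν)·Z + 4·2^ν·Z·(T−1)/(T+1)` against the gain `(2Nf+1)·T·G ≥ 4·2^ν·Z·(1 + (T−1)/(T+1))`
  (`cPRK ≤ 2.04 Z`, `L₀`-part of `log WC ≤ 0.22 Z`, order-proportional costs `≤ 0.07 Z +` surplus, box/centre/width terms `≤ 0.35·2^ν Z`);
* `oddF_holds`: the same at `ν = 0` with the odd radius `(12e^G+6)·Nh lev` and the gain `2·Nh·T·G ≥ 4Z(1 + (T−1)/(T+1))`.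

## References
* [Nesterenko2003] Yu. V. Nesterenko, LNM 1819 (2003) — §4.2 (4.24)–(4.35), p. 87–90.
-/

noncomputable section

open Finset Real
open scoped Nat
open Summit.ABC.StewartYu.ArchSupply (WC)
open Summit.ABC.StewartYu.ArchG3Setup (DΔC)

namespace Summit.ABC.StewartYu

namespace ArchG3Rec

open PadicG3Par (Cb Cb_pos)
open ArchG3Par (G K yloadK G_eq G_pos K_pos yloadK_pos)

variable {n : ℕ} (P : ArchG3Rec n)

/-- the constant debris of one (F) line: `4 + n·(WN + L/2^21 + 1) + X/8 + (19n + 47 + log N) + 2·ΣA + Z/(4·yload_K) ≤ Z/300`. [folklore] -/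
theorem lineF_debris_le (hn2 : 2 ≤ n) : 4 + (n : ℝ) * (P.WN + P.L / 2 ^ 21 + 1) + P.X / 8 + (19 * n + 47 + Real.log P.N) + 2 * P.SAR +
    P.Z / (4 * yloadK n) ≤ P.Z / 300 := by
  have hJ := P.junk_le
  obtain ⟨hZ0, -, hZn, -⟩ := P.Z_floors
  have hy := yloadK_ge P.hn
  have hy0 := yloadK_pos n
  have hlog := P.N_facts.2.2
  have hwl := (P.wl_facts 0).2
  have hX : (0 : ℝ) ≤ P.X := Nat.cast_nonneg _
  have hwX : 0 ≤ P.wl 0 * P.X := mul_nonneg hwl.le hX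
  have hL := P.L_real
  have hn : (2 : ℝ) ≤ n := by exact_mod_cast hn2
  have hp5 : P.Z / (4 * yloadK n) ≤ P.Z / 392 := by
    apply div_le_div_of_nonneg_left hZ0.le (by norm_num); rw [G_eq] at hy; linarith
  -- `7 n + 10 ≤ Z/2^20`: `Z ≥ 512 (n+1)^2 L`, `L ≥ 2^26`
  have h26 : (2 : ℝ) ^ 26 ≤ P.L := le_trans (pow_le_pow_right₀ (by norm_num) (by omega)) hL.2.2.1
  have hnZ : 7 * (n : ℝ) + 11 ≤ P.Z / 2 ^ 20 := by
    rw [le_div_iff₀ (by positivity)]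
    have h1 : (7 * (n : ℝ) + 11) * 2 ^ 20 ≤ 512 * ((n : ℝ) + 1) ^ 2 * 2 ^ 26 := by nlinarith only [hn]
    have h2 : 512 * ((n : ℝ) + 1) ^ 2 * 2 ^ 26 ≤ 512 * ((n : ℝ) + 1) ^ 2 * P.L := mul_le_mul_of_nonneg_left h26 (by positivity)
    linarith only [h1, h2, hZn]
  linarith only [hJ, hp5, hnZ, hlog, hwX, hZ0]

/-- **THE (F) LINE OF A k-STEP `(lev, ν) → (lev, ν+1)`** — the (F) conjunct of `KStepLinesK (2^(n−1)) c lev ν`, for `n ≥ 2`, `ν < n`,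
`lev ≤ Ŝ`, `2^63 ≤ c`. [cite: Nesterenko2003, §4.2 (4.24)–(4.35); shape only] -/
theorem kstepF_holds (hn2 : 2 ≤ n) (lev ν : ℕ) (hν : ν < n) (hlev : lev ≤ P.Sd) {c : ℝ} (hc : (2 : ℝ) ^ (3 + 60) ≤ c) :
    ∀ (x₁ : ℤ) (a : ℕ), |x₁| ≤ (P.Nf lev (ν + 1) : ℤ) → a < P.Tf lev (ν + 1) →
      P.γb lev * P.Nf lev (ν + 1) + P.cUR + P.cPRK (2 ^ (n - 1)) + Real.log (DΔC (P.YRK (2 ^ (n - 1)) lev) (P.Tf lev (ν + 1))) +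
        Real.log (WC P.H (P.Sd - lev) P.L₀ (P.Tf lev (ν + 1)) ((3 * Real.exp (G n) + 1) * (2 * P.Nf lev ν + 1) + P.Nf lev ν)) +
        (P.wl lev + (P.LbRK (2 ^ (n - 1)) lev P.jl : ℝ) * P.δR c) * ((3 * Real.exp (G n) + 1) * (2 * P.Nf lev ν + 1) + P.Nf lev ν) -
        (((2 * P.Nf lev ν + 1) * P.T lev : ℕ) : ℝ) * G n + P.cDR lev a |(x₁ : ℝ)| + Real.log 3 ≤ 0 := by
  intro x₁ a hx ha
  have hκ : 1 ≤ 2 ^ (n - 1) := Nat.one_le_two_pow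
  obtain ⟨hZ0, -, -, -⟩ := P.Z_floors
  have hx' : |(x₁ : ℝ)| ≤ (P.Nf lev (ν + 1) : ℝ) := by rw [← Int.cast_abs]; exact_mod_cast hx
  -- the atoms
  have hγ := P.γb_Nf_le lev ν
  obtain ⟨hU, -⟩ := P.cUR_le
  have hP := P.cPRK_two_pow_le hn2
  have hD := P.logDΔCK_le (2 ^ (n - 1)) hκ lev lev (ν + 1)
  obtain ⟨hρ0, hρ1, hρ2, -, -⟩ := P.rhoF_facts lev ν hν.le hlev
  have hW := P.logWC_le (e := P.Sd - lev) (Nat.sub_le _ _) (P.Tf lev (ν + 1)) hρ0 hρ1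
  have hL0 := P.L₀_mul_le hn2
  have hwl := P.wl_rhoF_step_le hn2 lev ν
  have hsm := P.small_of_U0 lev hρ0 hρ2 hc
  have hgain := P.gain_K_ge lev ν
  have hcDR := P.cDR_le' lev ν (ν + 1) a hx' ha
  have hT := P.Tcost_step_le hn2 lev (ν + 1) (by omega)
  have hdeb := P.lineF_debris_le hn2
  -- numerics
  have hn : (2 : ℝ) ≤ n := by exact_mod_cast hn2
  have hn1 : (0 : ℝ) < (n : ℝ) + 1 := by linarith
  have h2ν : (1 : ℝ) ≤ 2 ^ ν := one_le_pow₀ (by norm_num)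
  have h2ν0 : (0 : ℝ) ≤ 2 ^ ν := by positivity
  have hT1 : (1 : ℝ) ≤ P.T lev := by exact_mod_cast (P.T_facts lev).1
  have hfrac0 : 0 ≤ ((P.T lev - 1 : ℝ) / (P.T lev + 1)) := div_nonneg (by linarith) (by linarith)
  have hsur : 4 * P.Z * ((P.T lev - 1 : ℝ) / (P.T lev + 1)) ≤ 4 * 2 ^ ν * P.Z * ((P.T lev - 1 : ℝ) / (P.T lev + 1)) := by
    have h0 : 0 ≤ 4 * P.Z * ((P.T lev - 1 : ℝ) / (P.T lev + 1)) := by positivity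
    have := mul_le_mul_of_nonneg_right h2ν h0
    linarith only [this]
  have hq1 : 2 ^ ν * ((((n : ℝ) / (16 * ((n : ℝ) + 1))) + 1 / 1000) * P.Z) ≤ 2 ^ ν * ((1 / 16 + 1 / 1000) * P.Z) := by
    apply mul_le_mul_of_nonneg_left _ h2ν0
    apply mul_le_mul_of_nonneg_right _ hZ0.le
    have : (n : ℝ) / (16 * ((n : ℝ) + 1)) ≤ 1 / 16 := by rw [div_le_div_iff₀ (by positivity) (by norm_num)]; linarith
    linarith
  have hq2 : 2 ^ ν * (((1 + 1 / 2 ^ 20) * n / (4 * ((n : ℝ) + 1)) + 1 / 500) * P.Z) ≤ 2 ^ ν * ((1 / 4 + 1 / 2 ^ 21 + 1 / 500) * P.Z) := by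
    apply mul_le_mul_of_nonneg_left _ h2ν0
    apply mul_le_mul_of_nonneg_right _ hZ0.le
    have : (1 + 1 / 2 ^ 20) * (n : ℝ) / (4 * ((n : ℝ) + 1)) ≤ 1 / 4 + 1 / 2 ^ 21 := by
      rw [div_le_iff₀ (by positivity)]; nlinarith only [hn]
    linarith
  have hl3 : Real.log (3 : ℝ) ≤ 2 := by have := Real.log_le_sub_one_of_pos (show (0:ℝ) < 3 by norm_num); linarith
  -- split `(wl + LbRK·δR)·ρF`
  have esplit : (P.wl lev + (P.LbRK (2 ^ (n - 1)) lev P.jl : ℝ) * P.δR c) * ((3 * Real.exp (G n) + 1) * (2 * (P.Nf lev ν : ℝ) + 1) + P.Nf lev ν) =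
      P.wl lev * ((3 * Real.exp (G n) + 1) * (2 * (P.Nf lev ν : ℝ) + 1) + P.Nf lev ν) +
        (P.LbRK (2 ^ (n - 1)) lev P.jl : ℝ) * P.δR c * ((3 * Real.exp (G n) + 1) * (2 * (P.Nf lev ν : ℝ) + 1) + P.Nf lev ν) := by ring
  rw [esplit]
  have hνZ : P.Z ≤ 2 ^ ν * P.Z := by have := mul_le_mul_of_nonneg_right h2ν hZ0.le; linarith only [this]
  linarith only [hγ, hU, hP, hD, hW, hL0, hwl, hsm, hgain, hcDR, hT, hdeb, hsur, hq1, hq2, hl3, hνZ, hZ0, hfrac0]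

/-- **THE (F) LINE OF AN ODD STEP `(lev, 0) → (lev, 1)`** — the (F) conjunct of `OddStepLinesK (2^(n−1)) c lev`, for `n ≥ 2`, `lev ≤ Ŝ`,
`2^63 ≤ c`. [cite: Nesterenko2003, §4.2 with the nodes 𝒳_{s,0}; shape only] -/
theorem oddF_holds (hn2 : 2 ≤ n) (lev : ℕ) (hlev : lev ≤ P.Sd) {c : ℝ} (hc : (2 : ℝ) ^ (3 + 60) ≤ c) :
    ∀ (x₁ : ℤ) (a : ℕ), |x₁| ≤ (P.Nf lev 1 : ℤ) → a < P.Tf lev 1 →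
      P.γb lev * P.Nf lev 1 + P.cUR + P.cPRK (2 ^ (n - 1)) + Real.log (DΔC (P.YRK (2 ^ (n - 1)) lev) (P.Tf lev 1)) +
        Real.log (WC P.H (P.Sd - lev) P.L₀ (P.Tf lev 1) ((12 * Real.exp (G n) + 6) * P.Nh lev)) +
        (P.wl lev + (P.LbRK (2 ^ (n - 1)) lev P.jl : ℝ) * P.δR c) * ((12 * Real.exp (G n) + 6) * P.Nh lev) -
        (((2 * P.Nh lev) * P.T lev : ℕ) : ℝ) * G n + P.cDR lev a |(x₁ : ℝ)| + Real.log 3 ≤ 0 := by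
  intro x₁ a hx ha
  have hκ : 1 ≤ 2 ^ (n - 1) := Nat.one_le_two_pow
  obtain ⟨hZ0, -, -, -⟩ := P.Z_floors
  have hx' : |(x₁ : ℝ)| ≤ (P.Nf lev (0 + 1) : ℝ) := by rw [← Int.cast_abs]; exact_mod_cast hx
  -- the atoms
  have hγ := P.γb_Nf_le lev 0
  obtain ⟨hU, -⟩ := P.cUR_le
  have hP := P.cPRK_two_pow_le hn2
  have hD := P.logDΔCK_le (2 ^ (n - 1)) hκ lev lev 1
  obtain ⟨hρ0, hρ1, hρ2, -, -⟩ := P.rhoO_facts lev hlev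
  have hW := P.logWC_le (e := P.Sd - lev) (Nat.sub_le _ _) (P.Tf lev 1) hρ0 hρ1
  have hL0 := P.L₀_mul_le hn2
  have hwl := P.wl_rhoO_le hn2 lev
  have hsm := P.small_of_U0 lev hρ0 hρ2 hc
  have hgain := P.gain_O_ge lev
  have hcDR := P.cDR_le' lev 0 1 a hx' ha
  have hT := P.Tcost_step_le hn2 lev 1 le_rfl
  have hdeb := P.lineF_debris_le hn2
  -- numerics
  have hn : (2 : ℝ) ≤ n := by exact_mod_cast hn2
  have hn1 : (0 : ℝ) < (n : ℝ) + 1 := by linarith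
  have hT1 : (1 : ℝ) ≤ P.T lev := by exact_mod_cast (P.T_facts lev).1
  have hfrac0 : 0 ≤ ((P.T lev - 1 : ℝ) / (P.T lev + 1)) := div_nonneg (by linarith) (by linarith)
  simp only [pow_zero, one_mul, zero_add] at hγ hcDR
  have hq1 : (((n : ℝ) / (16 * ((n : ℝ) + 1))) + 1 / 1000) * P.Z ≤ (1 / 16 + 1 / 1000) * P.Z := by
    apply mul_le_mul_of_nonneg_right _ hZ0.le
    have : (n : ℝ) / (16 * ((n : ℝ) + 1)) ≤ 1 / 16 := by rw [div_le_div_iff₀ (by positivity) (by norm_num)]; linarith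
    linarith
  have hq2 : (((1 + 1 / 2 ^ 20) * n / (4 * ((n : ℝ) + 1)) + 1 / 500) * P.Z) ≤ (1 / 4 + 1 / 2 ^ 21 + 1 / 500) * P.Z := by
    apply mul_le_mul_of_nonneg_right _ hZ0.le
    have : (1 + 1 / 2 ^ 20) * (n : ℝ) / (4 * ((n : ℝ) + 1)) ≤ 1 / 4 + 1 / 2 ^ 21 := by
      rw [div_le_iff₀ (by positivity)]; nlinarith only [hn]
    linarith
  have hl3 : Real.log (3 : ℝ) ≤ 2 := by have := Real.log_le_sub_one_of_pos (show (0:ℝ) < 3 by norm_num); linarith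
  have esplit : (P.wl lev + (P.LbRK (2 ^ (n - 1)) lev P.jl : ℝ) * P.δR c) * ((12 * Real.exp (G n) + 6) * (P.Nh lev : ℝ)) =
      P.wl lev * ((12 * Real.exp (G n) + 6) * (P.Nh lev : ℝ)) +
        (P.LbRK (2 ^ (n - 1)) lev P.jl : ℝ) * P.δR c * ((12 * Real.exp (G n) + 6) * (P.Nh lev : ℝ)) := by ring
  rw [esplit]
  linarith only [hγ, hU, hP, hD, hW, hL0, hwl, hsm, hgain, hcDR, hT, hdeb, hq1, hq2, hl3, hZ0, hfrac0]

end ArchG3Rec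

end Summit.ABC.StewartYu
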